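import Literature.NumberTheory.LFunctions.TwistedConeCount
import Mathlib.NumberTheory.NumberField.InfinitePlace.TotallyRealComplex
import Mathlib.MeasureTheory.Function.Jacobian
import Mathlib.MeasureTheory.Integral.Pi
import Mathlib.Analysis.SpecialFunctions.ImproperIntegrals
import Mathlib.Analysis.SpecialFunctions.Integrals.Basic
import HarnessLib

/-!
# The twisted cone integrals `V_s(m) = ∫_{X_s} e_m` of a totally real field

Topic `Literature/NumberTheory/LFunctions`, sequel of `TwistedConeCount.lean` (cone coordinates
`c(x)`, the twist `e_m(x) = exp(2πi m·c(x))`, the sign parts `X_s = signPart K s` of Mathlib's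
norm-one domain `normLeOne K`, and `twistIntegral K s m = ∫_{X_s} e_m`). Everything in this file
is PROVED.

These integrals are the main terms of the twisted lattice sums `∑_{N𝔞 ≤ x} λ^m(𝔞)` of Hecke's
Grössencharaktere (E. Hecke, Math. Z. 6 (1920), §2; T. Mitsui, Jap. J. Math. 26 (1956), §1);
the prime number theorem with Grössencharakteren needs exactly that they VANISH for the
non-trivial characters. We prove:

* `twistIntegral_eq_twistIntegral_empty` — `V_s(m) = V_∅(m)` for every set `s` of real places
  (the sign flip `negAt s` preserves the volume and the absolute values of the coordinates), for
  every number field;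
* for `K` totally real: the volume-preserving identification of the mixed space with
  `ℝ^{[K:ℚ]}` (`toRealSpace`, `measurePreserving_toRealSpace`), the description
  `plusPart (normLeOne K) = toRealSpace ⁻¹' (expMapBasis '' paramSet K)`, the cone coordinates of
  Roblot's parametrization `coneCoord (expMapBasis p) = (p_{e(i)})_i`, and, by the change of
  variables `expMapBasis` (Mathlib's `abs_det_fderiv_expMapBasis`) and Fubini over the parameter
  box `paramSet K = (−∞, 0] × [0,1)^{rank}`,
  **`twistIntegral_empty_eq`**: `V_∅(m) = R_K · ∏_i ∫₀¹ e(m_i u) du`;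
* hence `twistIntegral_zero : V_s(0) = regulator K` and
  `twistIntegral_eq_zero : V_s(m) = 0` as soon as some `m_i` is a nonzero integer.

## References

* E. Hecke, *Eine neue Art von Zetafunktionen …* II, Math. Z. 6 (1920), 11–51, §2. [HeckeMathZ1920]
* T. Mitsui, *Generalized prime number theorem*, Jap. J. Math. 26 (1956), 1–42, §1. [cite: Mitsui1956, §1]
* D. A. Marcus, *Number Fields*, 2nd ed. (2018), Ch. 6, pp. 127–129 (the parametrization). [Marcus2018]

## Mathlib / tree search

Mathlib: `expMapBasis`, `paramSet`, `normLeOne_eq_preimage`, `hasFDerivAt_expMapBasis`,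
`abs_det_fderiv_expMapBasis`, `injective_expMapBasis`, `logMap_expMap`, `completeBasis_apply_of_ne`,
`logEmbedding_fundSystem`, `integral_image_eq_integral_abs_det_fderiv_smul`, `Measure.pi_eq`,
`Measure.restrict_pi_pi`, `integral_fintype_prod_eq_prod`, `integral_exp_mul_Iic`,
`integral_exp_mul_complex`, `volume_preserving_negAt`, `negAt_preimage`. Tree: `TwistedConeCount`.
-/

noncomputable section

open NumberField NumberField.InfinitePlace NumberField.mixedEmbedding
  NumberField.mixedEmbedding.fundamentalCone NumberField.Units NumberField.Units.dirichletUnitTheorem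
  MeasureTheory Module Set Finset
open scoped Real NNReal ENNReal Classical

namespace Literature.NumberTheory.LFunctions.HeckeCone

variable {K : Type*} [Field K] [NumberField K]

/-! ## Independence of the signs -/

omit [NumberField K] in
/-- `negAt ∅` is the identity. [folklore] -/
theorem negAt_empty_apply (x : mixedSpace K) : negAt (∅ : Set {w : InfinitePlace K // IsReal w}) x = x := by
  refine Prod.ext (funext fun w ↦ ?_) (negAt_apply_snd x)
  exact negAt_apply_isReal_and_notMem x (Set.notMem_empty w)

/-- `X_∅ = plusPart (normLeOne K)`. [folklore] -/
theorem signPart_empty : signPart K ∅ = plusPart (normLeOne K) := by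
  unfold signPart
  ext x
  constructor
  · rintro ⟨y, hy, rfl⟩; rwa [negAt_empty_apply]
  · intro hx; exact ⟨x, hx, negAt_empty_apply x⟩

/-- **`V_s(m) = V_∅(m)`**: the twisted cone integral does not depend on the signs.
[cite: Mitsui1956, §1] -/
theorem twistIntegral_eq_twistIntegral_empty (s : Set {w : InfinitePlace K // IsReal w})
    (m : Fin (rank K) → ℝ) : twistIntegral K s m = twistIntegral K ∅ m := by
  unfold twistIntegral
  rw [signPart_empty, signPart, ← negAt_preimage]
  have hemb : MeasurableEmbedding (negAt s : mixedSpace K → mixedSpace K) :=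
    (negAt s).toHomeomorph.measurableEmbedding
  have h := (volume_preserving_negAt (s := s) (K := K)).setIntegral_preimage_emb hemb (eTwist m)
    (plusPart (normLeOne K))
  rw [← h]
  refine setIntegral_congr_fun ?_ fun x _ ↦ ?_
  · exact (measurableSet_plusPart (measurableSet_normLeOne K)).preimage (negAt s).continuous.measurable
  · exact eTwist_eq_of_normAtPlace_eq m fun w ↦ (normAtPlace_negAt (s := s) x w).symm

/-! ## The cone coordinates of Roblot's parametrization -/

/-- For a parameter `q` with `q w₀ = 0`, `logMap (expMapBasis q) = ∑_i q_{e(i)} • b_i` with `b_i`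
the unit-lattice basis and `e : Fin (rank K) ≃ {w ≠ w₀}` Mathlib's `equivFinRank`. [folklore] -/
theorem logMap_expMapBasis_of_eq_zero {q : realSpace K} (hq : q w₀ = 0) :
    logMap (mixedSpaceOfRealSpace (expMapBasis q)) = ∑ i, q (equivFinRank i).1 • logBasis K i := by
  have hnorm : mixedEmbedding.norm (mixedSpaceOfRealSpace (expMapBasis q)) = 1 := by
    rw [norm_expMapBasis, hq, Real.exp_zero, one_pow]
  have h1 : logMap (mixedSpaceOfRealSpace (expMapBasis q)) =
      fun w : {w : InfinitePlace K // w ≠ w₀} ↦ ((completeBasis K).equivFun.symm q) w.1 := by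
    rw [expMapBasis_apply]
    exact logMap_expMap (by rw [← expMapBasis_apply]; exact hnorm)
  rw [h1]
  ext w
  rw [Basis.equivFun_symm_apply, Finset.sum_apply, Finset.sum_apply]
  simp only [Pi.smul_apply, smul_eq_mul]
  -- split the sum over all places into `w₀` and the others, reindexed by `equivFinRank`
  rw [Fintype.sum_eq_add_sum_subtype_ne _ w₀, hq, zero_mul, zero_add]
  rw [← Equiv.sum_comp equivFinRank]
  refine Finset.sum_congr rfl fun i _ ↦ ?_
  congr 1
  rw [completeBasis_apply_of_ne, Basis.ofZLatticeBasis_apply, ← logEmbedding_fundSystem,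
    Equiv.symm_apply_apply, expMap_symm_apply, normAtAllPlaces_apply, normAtPlace_apply,
    logEmbedding_component]

/-- **Cone coordinates of the parametrization**: `c(expMapBasis p)_i = p_{e(i)}`.
[cite: Marcus2018, Ch. 6, p. 128] -/
theorem coneCoord_expMapBasis (p : realSpace K) (i : Fin (rank K)) :
    coneCoord (mixedSpaceOfRealSpace (expMapBasis p)) i = p (equivFinRank i).1 := by
  -- remove the radial coordinate
  set q : realSpace K := fun w ↦ if w = w₀ then 0 else p w with hq
  have hq0 : q w₀ = 0 := by simp [hq]
  have hp : expMapBasis p = Real.exp (p w₀) • expMapBasis q := expMapBasis_apply'' p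
  have hsmul : mixedSpaceOfRealSpace (expMapBasis p) = Real.exp (p w₀) • mixedSpaceOfRealSpace (expMapBasis q) := by
    rw [hp, map_smul]
  have hnz : mixedEmbedding.norm (mixedSpaceOfRealSpace (expMapBasis q)) ≠ 0 := norm_expMapBasis_ne_zero q
  rw [hsmul, coneCoord_smul hnz (Real.exp_ne_zero _)]
  unfold coneCoord
  rw [logMap_expMapBasis_of_eq_zero hq0, map_sum]
  simp only [map_smul, Basis.repr_self, Finsupp.coe_finsetSum, Finsupp.coe_smul, Finset.sum_apply,
    Pi.smul_apply, Finsupp.single_apply, smul_eq_mul, mul_ite, mul_one, mul_zero,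
    Finset.sum_ite_eq', Finset.mem_univ, if_true]
  rw [hq]; dsimp only
  rw [if_neg (equivFinRank i).2]

/-! ## Totally real fields: the mixed space is `ℝ^d` -/

section TotallyReal

variable [IsTotallyReal K]

omit [NumberField K] in
/-- A totally real field has no complex places. [folklore] -/
theorem isEmpty_isComplex : IsEmpty {w : InfinitePlace K // w.IsComplex} :=
  ⟨fun w ↦ (not_isReal_iff_isComplex.2 w.2) (IsTotallyReal.isReal w.1)⟩

variable (K) in
/-- The identification of the mixed space of a totally real field with `realSpace K` as a
bijection: `x ↦ (x_w)_w` (all places are real), inverse Mathlib's `mixedSpaceOfRealSpace`. [folklore] -/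
def toRealSpaceEquiv : mixedSpace K ≃ realSpace K where
  toFun x w := x.1 ⟨w, IsTotallyReal.isReal w⟩
  invFun := mixedSpaceOfRealSpace
  left_inv x := by
    haveI := isEmpty_isComplex (K := K)
    exact Prod.ext (funext fun w ↦ rfl) (Subsingleton.elim _ _)
  right_inv y := funext fun w ↦ rfl

variable (K) in
/-- The identification of the mixed space of a totally real field with `realSpace K`, as a
measurable equivalence. [folklore] -/
def toRealSpace : mixedSpace K ≃ᵐ realSpace K where
  toEquiv := toRealSpaceEquiv K
  measurable_toFun := by
    change Measurable fun (x : mixedSpace K) (w : InfinitePlace K) ↦ x.1 ⟨w, IsTotallyReal.isReal w⟩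
    exact measurable_pi_iff.mpr fun w ↦ (measurable_pi_apply _).comp measurable_fst
  measurable_invFun := by
    change Measurable (mixedSpaceOfRealSpace : realSpace K → mixedSpace K)
    exact mixedSpaceOfRealSpace.continuous.measurable

/-- Unfolding lemma for `toRealSpace`. [folklore] -/
theorem toRealSpace_apply (x : mixedSpace K) (w : InfinitePlace K) :
    toRealSpace K x w = x.1 ⟨w, IsTotallyReal.isReal w⟩ := rfl

/-- The inverse identification is Mathlib's `mixedSpaceOfRealSpace`. [folklore] -/
theorem toRealSpace_symm_apply (y : realSpace K) :
    (toRealSpace K).symm y = mixedSpaceOfRealSpace y := rfl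

/-- **The identification is volume preserving.** [folklore] -/
theorem measurePreserving_toRealSpace : MeasurePreserving (toRealSpace K) volume volume := by
  haveI := isEmpty_isComplex (K := K)
  refine ⟨(toRealSpace K).measurable, ?_⟩
  symm
  refine Measure.pi_eq fun t ht ↦ ?_
  rw [Measure.map_apply (toRealSpace K).measurable (MeasurableSet.univ_pi ht)]
  have hpre : (toRealSpace K) ⁻¹' Set.univ.pi t =
      (Set.univ.pi fun w : {w : InfinitePlace K // IsReal w} ↦ t w.1) ×ˢ (Set.univ : Set ({w : InfinitePlace K // IsComplex w} → ℂ)) := by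
    ext x
    simp only [Set.mem_preimage, Set.mem_univ_pi, toRealSpace_apply, Set.mem_prod, Set.mem_univ, and_true,
      Subtype.forall]
    constructor
    · intro h w hw; exact h w
    · intro h w; exact h w (IsTotallyReal.isReal w)
  rw [hpre, Measure.volume_eq_prod, Measure.prod_prod,
    show (volume : Measure ({w : InfinitePlace K // IsComplex w} → ℂ)) Set.univ = 1 from by
      rw [volume_pi, Measure.pi_empty_univ], mul_one, volume_pi, Measure.pi_pi]
  -- reindex the product over the real places
  let e : InfinitePlace K ≃ {w : InfinitePlace K // IsReal w} :=
    { toFun := fun w ↦ ⟨w, IsTotallyReal.isReal w⟩, invFun := fun w ↦ w.1,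
      left_inv := fun _ ↦ rfl, right_inv := fun _ ↦ rfl }
  rw [← e.prod_comp]
  rfl

/-- For a point with positive real coordinates, `normAtAllPlaces` is the identification.
[folklore] -/
theorem normAtAllPlaces_eq_toRealSpace {x : mixedSpace K} (hx : ∀ w, 0 < x.1 w) :
    normAtAllPlaces x = toRealSpace K x := by
  ext w
  rw [normAtAllPlaces_apply, toRealSpace_apply, normAtPlace_apply_of_isReal (IsTotallyReal.isReal w),
    Real.norm_of_nonneg (hx _).le]

/-- **The positive part of the norm-one domain in the parametrization**:
`plusPart (normLeOne K) = toRealSpace ⁻¹' (expMapBasis '' paramSet K)`. [cite: Marcus2018, Ch. 6, p. 128] -/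
theorem plusPart_normLeOne_eq_preimage :
    plusPart (normLeOne K) = (toRealSpace K) ⁻¹' (expMapBasis '' paramSet K) := by
  ext x
  constructor
  · rintro ⟨hx, hpos⟩
    rw [Set.mem_preimage, ← normAtAllPlaces_eq_toRealSpace hpos]
    have := hx
    rw [normLeOne_eq_preimage] at this
    exact this
  · intro hx
    rw [Set.mem_preimage] at hx
    have hpos : ∀ w, 0 < x.1 w := by
      intro w
      obtain ⟨p, -, hp⟩ := hx
      have h := congrFun hp w.1
      rw [toRealSpace_apply] at h
      have : x.1 w = x.1 ⟨w.1, IsTotallyReal.isReal w.1⟩ := rfl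
      rw [this, ← h]
      exact expMapBasis_pos p w.1
    refine ⟨?_, hpos⟩
    rw [normLeOne_eq_preimage, Set.mem_preimage, normAtAllPlaces_eq_toRealSpace hpos]
    exact hx

/-- The twist at the parametrization: `e_m((toRealSpace)⁻¹ (expMapBasis p)) = e(∑ m_i p_{e(i)})`.
[folklore] -/
theorem eTwist_symm_expMapBasis (m : Fin (rank K) → ℝ) (p : realSpace K) :
    eTwist m ((toRealSpace K).symm (expMapBasis p)) =
      Complex.exp (2 * π * Complex.I * (∑ i, m i * p (equivFinRank i).1 : ℝ)) := by
  rw [toRealSpace_symm_apply, eTwist]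
  simp_rw [coneCoord_expMapBasis]

/-- The one-dimensional factor `J(k) = ∫₀¹ e(k u) du`. [folklore] -/
def unitIntervalTwist (k : ℝ) : ℂ := ∫ u in Set.Ico (0 : ℝ) 1, Complex.exp (2 * π * Complex.I * (k * u : ℝ))

/-- `J(0) = 1`. [folklore] -/
theorem unitIntervalTwist_zero : unitIntervalTwist 0 = 1 := by
  unfold unitIntervalTwist
  simp

/-- `J(k) = 0` for a nonzero integer `k`. [folklore] -/
theorem unitIntervalTwist_intCast {k : ℤ} (hk : k ≠ 0) : unitIntervalTwist k = 0 := by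
  unfold unitIntervalTwist
  set c : ℂ := 2 * π * Complex.I * k with hc
  have hc0 : c ≠ 0 := by
    rw [hc]; refine mul_ne_zero (mul_ne_zero (mul_ne_zero two_ne_zero ?_) Complex.I_ne_zero) ?_
    · exact_mod_cast Real.pi_ne_zero
    · exact_mod_cast hk
  have hfun : (fun u : ℝ ↦ Complex.exp (2 * π * Complex.I * ((k : ℝ) * u : ℝ))) = fun u : ℝ ↦ Complex.exp (c * u) := by
    funext u; congr 1; rw [hc]; push_cast; ring
  rw [hfun, setIntegral_congr_set Ico_ae_eq_Ioc, ← intervalIntegral.integral_of_le zero_le_one,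
    integral_exp_mul_complex hc0]
  have h1 : Complex.exp (c * (1 : ℝ)) = 1 := by
    rw [hc]; push_cast; rw [mul_one]
    have : 2 * (π : ℂ) * Complex.I * k = k * (2 * π * Complex.I) := by ring
    rw [this, Complex.exp_int_mul_two_pi_mul_I]
  rw [h1]; simp

/-- **The twisted cone integral of a totally real field**:
`V_∅(m) = R_K · ∏_i ∫₀¹ e(m_i u) du`. [cite: Mitsui1956, §1] -/
theorem twistIntegral_empty_eq (m : Fin (rank K) → ℝ) :
    twistIntegral K ∅ m = (regulator K : ℂ) * ∏ i, unitIntervalTwist (m i) := by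
  haveI := isEmpty_isComplex (K := K)
  have hd : 0 < finrank ℚ K := finrank_pos
  -- Step 1: to `realSpace K`
  have h1 : twistIntegral K ∅ m = ∫ y in expMapBasis '' paramSet K, eTwist m ((toRealSpace K).symm y) := by
    rw [twistIntegral, signPart_empty, plusPart_normLeOne_eq_preimage]
    rw [← (measurePreserving_toRealSpace (K := K)).setIntegral_preimage_emb (toRealSpace K).measurableEmbedding]
    refine setIntegral_congr_fun ((toRealSpace K).measurable ?_) fun x _ ↦ ?_
    · exact (measurableSet_paramSet K).image_of_continuousOn_injOn (continuous_expMapBasis K).continuousOn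
        (injective_expMapBasis K).injOn
    · rw [(toRealSpace K).symm_apply_apply]
  -- Step 2: change of variables `y = expMapBasis p`
  have h2 : ∫ y in expMapBasis '' paramSet K, eTwist m ((toRealSpace K).symm y) =
      ∫ p in paramSet K, |(fderiv_expMapBasis K p).det| • eTwist m ((toRealSpace K).symm (expMapBasis p)) :=
    integral_image_eq_integral_abs_det_fderiv_smul volume (measurableSet_paramSet K)
      (fun p _ ↦ (hasFDerivAt_expMapBasis K p).hasFDerivWithinAt) (injective_expMapBasis K).injOn _
  -- Step 3: the integrand is a product of one-variable functions
  set d : ℕ := finrank ℚ K with hdK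
  set F : InfinitePlace K → ℝ → ℂ := fun w u ↦
    if hw : w = w₀ then ((Real.exp (u * d) * d * regulator K : ℝ) : ℂ)
    else Complex.exp (2 * π * Complex.I * (m (equivFinRank.symm ⟨w, hw⟩) * u : ℝ)) with hF
  have hFw₀ : ∀ u, F w₀ u = ((Real.exp (u * d) * d * regulator K : ℝ) : ℂ) := fun u ↦ by
    simp only [hF, dif_pos rfl]
  have hFne : ∀ (w : {w : InfinitePlace K // w ≠ w₀}) (u : ℝ),
      F w.1 u = Complex.exp (2 * π * Complex.I * (m (equivFinRank.symm w) * u : ℝ)) := fun w u ↦ by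
    simp only [hF, dif_neg w.2]
  have hintegrand : ∀ p : realSpace K,
      |(fderiv_expMapBasis K p).det| • eTwist m ((toRealSpace K).symm (expMapBasis p)) = ∏ w, F w (p w) := by
    intro p
    rw [abs_det_fderiv_expMapBasis, eTwist_symm_expMapBasis, Fintype.prod_eq_mul_prod_subtype_ne _ w₀, hFw₀,
      Finset.univ_eq_empty, Finset.prod_empty, inv_one, mul_one, IsTotallyReal.nrComplexPlaces_eq_zero,
      pow_zero, mul_one, Complex.real_smul]
    congr 1
    rw [Finset.prod_congr rfl fun (w : {w : InfinitePlace K // w ≠ w₀}) _ ↦ hFne w (p w.1),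
      ← Equiv.prod_comp equivFinRank, ← Complex.exp_sum]
    congr 1
    push_cast
    rw [Finset.mul_sum]
    refine Finset.sum_congr rfl fun i _ ↦ ?_
    rw [Equiv.symm_apply_apply]
  -- Step 4: Fubini over the box
  have h4 : ∫ p in paramSet K, ∏ w, F w (p w) =
      ∏ w, ∫ u in (if w = w₀ then Set.Iic (0 : ℝ) else Set.Ico 0 1), F w u := by
    rw [paramSet, volume_pi, Measure.restrict_pi_pi]
    exact integral_fintype_prod_eq_prod (𝕜 := ℂ) F
  -- Step 5: the one-dimensional integrals
  have h5a : ∫ u in Set.Iic (0 : ℝ), F w₀ u = (regulator K : ℂ) := by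
    simp_rw [hFw₀]
    rw [integral_complex_ofReal]
    congr 1
    have hdr : 0 < (d : ℝ) := by exact_mod_cast hd
    have hI := integral_exp_mul_Iic hdr 0
    rw [show (fun u : ℝ ↦ Real.exp (u * d) * d * regulator K) =
        fun u : ℝ ↦ ((d : ℝ) * regulator K) * Real.exp ((d : ℝ) * u) by funext u; rw [mul_comm u]; ring,
      integral_const_mul, hI, mul_zero, Real.exp_zero]
    field_simp
  have h5b : ∀ w : {w : InfinitePlace K // w ≠ w₀},
      ∫ u in Set.Ico (0 : ℝ) 1, F w.1 u = unitIntervalTwist (m (equivFinRank.symm w)) := fun w ↦ by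
    simp_rw [hFne]; rfl
  rw [h1, h2, integral_congr_ae (Filter.Eventually.of_forall hintegrand) |>.trans h4,
    Fintype.prod_eq_mul_prod_subtype_ne _ w₀, if_pos rfl, h5a]
  congr 1
  rw [Finset.prod_congr rfl fun (w : {w : InfinitePlace K // w ≠ w₀}) _ ↦ by rw [if_neg w.2, h5b w],
    ← Equiv.prod_comp equivFinRank]
  refine Finset.prod_congr rfl fun i _ ↦ ?_
  rw [Equiv.symm_apply_apply]

/-- **`V_s(0) = R_K`** for a totally real field. [cite: Mitsui1956, §1] -/
theorem twistIntegral_zero (s : Set {w : InfinitePlace K // IsReal w}) :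
    twistIntegral K s 0 = (regulator K : ℂ) := by
  rw [twistIntegral_eq_twistIntegral_empty, twistIntegral_empty_eq]
  simp [unitIntervalTwist_zero]

/-- **`V_s(m) = 0` when some `m_i` is a nonzero integer** (in particular for every nonzero
integral frequency vector): the main term of the twisted lattice sums of a non-trivial
Grössencharakter vanishes. [cite: Mitsui1956, §1] -/
theorem twistIntegral_eq_zero (s : Set {w : InfinitePlace K // IsReal w}) {m : Fin (rank K) → ℝ}
    {i : Fin (rank K)} {k : ℤ} (hk : k ≠ 0) (hi : m i = k) : twistIntegral K s m = 0 := by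
  rw [twistIntegral_eq_twistIntegral_empty, twistIntegral_empty_eq]
  refine mul_eq_zero_of_right _ (Finset.prod_eq_zero (Finset.mem_univ i) ?_)
  rw [hi]; exact unitIntervalTwist_intCast hk

end TotallyReal

end Literature.NumberTheory.LFunctions.HeckeCone

end
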